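import Literature.NumberTheory.EllipticCurves.EichlerShimuraPeriodsGamma1CuspMomentsProofs
import Literature.NumberTheory.EllipticCurves.PeriodRationality
import Literature.NumberTheory.EllipticCurves.HeckeOperatorsProofs
import HarnessLib

/-!
# Absolutely convergent cusp-to-`i∞` ray integrals `∫_r^{i∞} f(z) zʲ dz` in weight `k`

Topic `Literature/NumberTheory/EllipticCurves`, namespace
`Literature.NumberTheory.EllipticCurves.ModularForms` (continuing `ModularSymbolsProofs`,
`EichlerShimuraPeriods`, `EichlerShimuraPeriodsGamma1CuspMomentsProofs`).

For a cusp form `f ∈ S_k(Γ₀(N))` of ANY weight `k` and a rational cusp `r = a/c = γ∞`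
(`γ = (a b; c d) ∈ SL(2, ℤ)`, `c ≠ 0`) the ray integrands `t ↦ f(r + it) (r + it)ʲ` are
absolutely integrable on `(0, ∞)` for EVERY `j ∈ ℕ` (`integrableOn_cuspRay_mul_pow`,
`integrableOn_cuspRay_head`): near `∞`
by the exponential decay of `f` along vertical rays; near `t = 0⁺` by the substitution
`t = 1/(c²u)` of `ModularSymbolsProofs` (`γ` maps the ray above `γ⁻¹∞ = -d/c` onto the ray above
`γ∞ = a/c`), which in weight `k` turns `f(a/c + it) dt` into
`(f ∣[k] γ)(-d/c + iu) (icu)ᵏ du/(c²u²)` (`jacobian_smul_ray_zpow`) — exponentially decaying in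
`u` times a function of polynomial growth.  (The tree's
`EichlerShimuraPeriodsGamma1CuspMomentsProofs.integrableOn_cuspRayFn` proves integrability at an
ARBITRARY real point for `2j > k − 2` only, from the trivial bound `|f(z)| ≪ (im z)^{−k/2}`; at
rational cusps there is no restriction on `j`.)

Hence the **cusp ray moments** `rayMoment f j x = ∫_x^{i∞} f(z) zʲ dz := i ∫₀^∞ f(x + it)(x + it)ʲ dt`
(`x ∈ ℝ`; for `x ∈ ℚ` an honest Bochner integral of an integrable function), with

* `rayMoment_zero_left` — at the cusp `0`: `∫_0^{i∞} f(z) zʲ dz = i^{j+1} Λ(f, j+1)` where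
  `Λ(f, n) = completedLValue f n = ∫₀^∞ f(it) t^{n−1} dt` (Paşol–Popa (5.7));
* `rayMoment_add_one` — translation: `∫_{x+1}^{i∞} f(z) zʲ dz = ∑ᵢ C(j,i) ∫_x^{i∞} f(z) zⁱ dz`
  (`f(z + 1) = f(z)`);
* `integral_cuspRay_comp_div` — the level-`m` scaling behind the operators `(1 b; 0 m)`:
  `∫₀^∞ F((x + b)/m + it) G(t) dt = (1/m)… = ∫₀^∞ F(((x + b) + is)/m) G(s/m) ds / m`, a pure change of
  variables (no integrability needed), the engine of the distribution relation of the
  Mazur–Tate–Teitelbaum measure in weight `k` (Bellaïche, *The Eigenbook*, §6.7.3: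
  `μ(zʲ 1_{a+pⁿℤ_p}) = α^{−n} Φ({∞} − {a/pⁿ})((a + pⁿz)ʲ)`).

* `sum_apply_tpB_smul`, `sum_integral_cuspRay_div_eq(_of_eigen)` — **the distribution relation
  engine**: for `F ∈ S_k(Γ₀(L))`, `p ∣ L` prime, `∑_{b mod p} F((τ + b)/p) = p (U_p F)(τ)`
  (Diamond–Shurman Prop. 5.2.1 at a level divisible by `p`), hence
  `∑_{b mod p} ∫₀^∞ F((r + b)/p + it) G(t) dt = ∫₀^∞ (U_p F)(r + is) G(s/p) ds`
  `= α ∫₀^∞ F(r + is) G(s/p) ds` when `U_p F = α F` (MTT 1986, §I.10).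

Everything is proved; there are no named facts.

## References

* Ju. I. Manin, *Periods of parabolic forms and p-adic Hecke series*, Mat. Sb. 92 (1973), §1–§2
  (integrals between cusps, the continued-fraction trick). [Manin1973]
* B. Mazur, J. Tate, J. Teitelbaum, *On p-adic analogues of the conjectures of Birch and
  Swinnerton-Dyer*, Invent. Math. 84 (1986), §I.3–§I.10. [MazurTateTeitelbaum1986Invent]
* V. Paşol, A. A. Popa, *Modular forms and period polynomials*, Proc. LMS 107 (2013), eq. (5.7). [PasolPopa2013]
-/

noncomputable section

open scoped MatrixGroups ModularForm Topology Manifold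

open CongruenceSubgroup Complex MeasureTheory Set Filter Function Asymptotics
open UpperHalfPlane hiding I

namespace Literature.NumberTheory.EllipticCurves.ModularForms

/-! ### Rays from interior points against weights of polynomial growth -/

section InteriorRays

variable {h : ℝ} {φ : ℍ → ℂ}

/-- **Integrability of `φ(τ + it) G(t)` on `(0, ∞)`** for a cusp function `φ`, an interior point
`τ ∈ ℍ` and a continuous weight `G` of polynomial growth, `‖G(t)‖ ≤ A (1 + t)ᵐ` (`t ≥ 0`):
exponential decay of `φ` along the ray beats polynomial growth. [folklore] -/
theorem IsCuspFunction.integrableOn_ray_mul_of_norm_le (hφ : IsCuspFunction h φ) (τ : ℍ)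
    {G : ℝ → ℂ} (hG : ContinuousOn G (Ici 0)) {A : ℝ} {m : ℕ}
    (hGb : ∀ t : ℝ, 0 ≤ t → ‖G t‖ ≤ A * (1 + t) ^ m) :
    IntegrableOn (fun t : ℝ ↦ φ (ofComplex ((τ : ℂ) + t * I)) * G t) (Ioi 0) := by
  have hh := hφ.pos
  obtain ⟨C, hC0, hC⟩ := hφ.exists_norm_ray_le_of_nonneg τ
  have ha : 0 < 2 * Real.pi / h := by positivity
  refine Integrable.mono' (integrableOn_affine_pow_mul_exp_neg (C * A) 1 m ha) ?_ ?_
  · exact ((hφ.continuousOn_ray τ).mul (hG.mono Ioi_subset_Ici_self)).aestronglyMeasurable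
      measurableSet_Ioi
  · rw [ae_restrict_iff' measurableSet_Ioi]
    refine Eventually.of_forall fun t (ht : 0 < t) ↦ ?_
    rw [norm_mul]
    calc ‖φ (ofComplex ((τ : ℂ) + t * I))‖ * ‖G t‖
        ≤ (C * Real.exp (-(2 * Real.pi / h) * t)) * (A * (1 + t) ^ m) := by
          refine mul_le_mul (hC t ht.le) (hGb t ht.le) (norm_nonneg _) ?_
          exact mul_nonneg hC0 (Real.exp_pos _).le
      _ = C * A * (1 + t) ^ m * Real.exp (-(2 * Real.pi / h) * t) := by ring

end InteriorRays

/-! ### The weight-`k` substitution along the ray above a cusp `γ∞ = a/c` -/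

section CuspRays

variable {N : ℕ} {k : ℤ} (f : CuspForm (Gamma0 N) k) (g : SL(2, ℤ))

/-- **Weight-`k` transformation along the ray**: with `t = 1/(c²u)`,
`f(a/c + it) · |dt/du| = f(γ(-d/c + iu))/(c²u²) = (f ∣[k] γ)(-d/c + iu) (icu)ᵏ/(c²u²)` since
`c(-d/c + iu) + d = icu` (weight `2`: `jacobian_smul_ray`). [folklore] -/
theorem jacobian_smul_ray_zpow (hc : (g 1 0 : ℤ) ≠ 0) {u : ℝ} (hu : 0 < u) :
    |(-(1 / (((g 1 0 : ℤ) : ℝ) ^ 2 * u ^ 2)) : ℝ)| •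
      f (ofComplex (((g 0 0 : ℤ) : ℂ) / ((g 1 0 : ℤ) : ℂ) +
        ((1 / (((g 1 0 : ℤ) : ℝ) ^ 2 * u) : ℝ) : ℂ) * I)) =
      (⇑f ∣[k] g) (ofComplex (-((g 1 1 : ℤ) : ℂ) / ((g 1 0 : ℤ) : ℂ) + u * I)) *
        ((((g 1 0 : ℤ) : ℂ) * u * I) ^ k / (((g 1 0 : ℤ) : ℂ) ^ 2 * u ^ 2)) := by
  have hc' : ((g 1 0 : ℤ) : ℂ) ≠ 0 := by exact_mod_cast hc
  have hu' : (u : ℂ) ≠ 0 := by exact_mod_cast hu.ne'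
  have him : 0 < (-((g 1 1 : ℤ) : ℂ) / ((g 1 0 : ℤ) : ℂ) + u * I).im := by
    simpa [div_im] using hu
  have hD : ((g 1 0 : ℤ) : ℂ) * u * I ≠ 0 := mul_ne_zero (mul_ne_zero hc' hu') I_ne_zero
  rw [ModularForm.SL_slash_apply, smul_ofComplex g him, moebius_ray g hc hu.ne',
    denom_ofComplex g him, denom_ray g hc u, abs_of_neg (by
      have : 0 < 1 / (((g 1 0 : ℤ) : ℝ) ^ 2 * u ^ 2) := by positivity
      linarith), Complex.real_smul]
  rw [zpow_neg]
  push_cast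
  field_simp

variable [NeZero N]

/-- **Integrability of `t ↦ f(a/c + it)` near the cusp, in weight `k`** (`γ∞ = a/c`, `c ≠ 0`): on
`(0, 1/|c|)`, the image of the ray above `w₀ = -d/c + i/|c|` under `u ↦ 1/(c²u)`, the substitution
turns the integrand into `(f ∣[k] γ)(-d/c + iu)(icu)ᵏ/(c²u²)`, exponentially small times a weight of
polynomial growth (the weight-`k` version of the head estimate in
`integrableOn_modularSymbol_integrand_smul`). [cite: Manin1973, §1] -/
theorem integrableOn_cuspRay_head (hc : (g 1 0 : ℤ) ≠ 0) :
    IntegrableOn (fun t : ℝ ↦ f (ofComplex (((g 0 0 : ℤ) : ℂ) / ((g 1 0 : ℤ) : ℂ) + t * I)))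
      (Ioo 0 (1 / |((g 1 0 : ℤ) : ℝ)|)) := by
  have hCR : ((g 1 0 : ℤ) : ℝ) ≠ 0 := by exact_mod_cast hc
  have hCa : (0 : ℝ) < |((g 1 0 : ℤ) : ℝ)| := abs_pos.mpr hCR
  have hT : (0 : ℝ) < 1 / |((g 1 0 : ℤ) : ℝ)| := by positivity
  rw [← image_inv_ray hCR, integrableOn_image_iff_integrableOn_abs_deriv_smul
    measurableSet_Ioi (fun u hu ↦ (hasDerivAt_inv_ray hCR
      (lt_trans hT hu).ne').hasDerivWithinAt) (injOn_inv_ray hCR _)]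
  -- the weight: `G(t) = (ic(t+T))ᵏ/(c²(t+T)²)`, of polynomial growth
  set T : ℝ := 1 / |((g 1 0 : ℤ) : ℝ)| with hTdef
  set G : ℝ → ℂ := fun t ↦ (((g 1 0 : ℤ) : ℂ) * ((t + T : ℝ) : ℂ) * I) ^ k /
    (((g 1 0 : ℤ) : ℂ) ^ 2 * ((t + T : ℝ) : ℂ) ^ 2) with hGdef
  have hcT : |((g 1 0 : ℤ) : ℝ)| * T = 1 := by rw [hTdef]; field_simp
  have hnormD : ∀ t : ℝ, 0 ≤ t →
      ‖((g 1 0 : ℤ) : ℂ) * ((t + T : ℝ) : ℂ) * I‖ = 1 + |((g 1 0 : ℤ) : ℝ)| * t := by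
    intro t ht
    rw [norm_mul, norm_mul, Complex.norm_I, mul_one, Complex.norm_intCast, Complex.norm_real,
      Real.norm_of_nonneg (by positivity), mul_add, hcT]
    ring
  have hGcont : ContinuousOn G (Ici 0) := by
    refine ContinuousOn.div ?_ (by fun_prop) fun t (ht : 0 ≤ t) ↦ ?_
    · refine ContinuousOn.zpow₀ (by fun_prop) k fun t (ht : 0 ≤ t) ↦ Or.inl ?_
      have hpos : 0 < 1 + |((g 1 0 : ℤ) : ℝ)| * t := by positivity
      intro h0
      have := hnormD t ht
      rw [h0, norm_zero] at this
      linarith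
    · have hc' : ((g 1 0 : ℤ) : ℂ) ≠ 0 := by exact_mod_cast hc
      have htT : ((t + T : ℝ) : ℂ) ≠ 0 := by
        have : 0 < t + T := by positivity
        exact_mod_cast this.ne'
      exact mul_ne_zero (pow_ne_zero 2 hc') (pow_ne_zero 2 htT)
  have hGb : ∀ t : ℝ, 0 ≤ t →
      ‖G t‖ ≤ (1 + |((g 1 0 : ℤ) : ℝ)|) ^ (k - 2).toNat * (1 + t) ^ (k - 2).toNat := by
    intro t ht
    have hB : 1 ≤ 1 + |((g 1 0 : ℤ) : ℝ)| * t := le_add_of_nonneg_right (by positivity)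
    have hden : ((g 1 0 : ℤ) : ℂ) ^ 2 * ((t + T : ℝ) : ℂ) ^ 2 =
        (((g 1 0 : ℤ) : ℂ) * ((t + T : ℝ) : ℂ) * I) ^ 2 * (-1) := by
      rw [mul_pow, mul_pow, I_sq]; ring
    have hval : ‖G t‖ = (1 + |((g 1 0 : ℤ) : ℝ)| * t) ^ (k - 2) := by
      rw [hGdef]
      dsimp only
      rw [hden, norm_div, norm_mul, norm_neg, norm_one, mul_one, norm_zpow, norm_pow, hnormD t ht,
        ← zpow_natCast, ← zpow_sub₀ (by positivity)]
      norm_num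
    rw [hval, ← mul_pow]
    calc (1 + |((g 1 0 : ℤ) : ℝ)| * t) ^ (k - 2)
        ≤ (1 + |((g 1 0 : ℤ) : ℝ)| * t) ^ (((k - 2).toNat : ℕ) : ℤ) :=
          zpow_le_zpow_right₀ hB (Int.self_le_toNat _)
      _ = (1 + |((g 1 0 : ℤ) : ℝ)| * t) ^ (k - 2).toNat := zpow_natCast _ _
      _ ≤ ((1 + |((g 1 0 : ℤ) : ℝ)|) * (1 + t)) ^ (k - 2).toNat := by
          apply pow_le_pow_left₀ (by positivity)
          nlinarith [abs_nonneg (((g 1 0 : ℤ) : ℝ)), ht]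
  have H : IntegrableOn (fun t : ℝ ↦ (⇑f ∣[k] g)
      (ofComplex (((ofComplex (rayBase g) : ℍ) : ℂ) + t * I)) * G t) (Ioi 0) :=
    (isCuspFunction_slash f g).integrableOn_ray_mul_of_norm_le _ hGcont hGb
  rw [integrableOn_Ioi_iff_integrableOn_Ioi_add]
  refine H.congr_fun (fun t (ht : 0 < t) ↦ ?_) measurableSet_Ioi
  dsimp only
  rw [jacobian_smul_ray_zpow f g hc (add_pos ht hT), coe_ofComplex_rayBase g hc, hGdef]
  dsimp only
  rw [rayBase, hTdef]
  push_cast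
  ring_nf

/-- **Integrability of `t ↦ f(a/c + it)(a/c + it)ʲ` on `(0, ∞)` in weight `k`, for EVERY `j`**
(`γ∞ = a/c`, `c ≠ 0`): on `(0, 1/|c|]` the polynomial factor is bounded and `t ↦ f(a/c + it)` is
integrable (`integrableOn_cuspRay_head`); on `(1/|c|, ∞)` exponential decay beats `tʲ`. [cite: Manin1973, §1] -/
theorem integrableOn_cuspRay_mul_pow (hc : (g 1 0 : ℤ) ≠ 0) (j : ℕ) :
    IntegrableOn (fun t : ℝ ↦ f (ofComplex (((g 0 0 : ℤ) : ℂ) / ((g 1 0 : ℤ) : ℂ) + t * I)) *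
      (((g 0 0 : ℤ) : ℂ) / ((g 1 0 : ℤ) : ℂ) + t * I) ^ j) (Ioi 0) := by
  have hCR : ((g 1 0 : ℤ) : ℝ) ≠ 0 := by exact_mod_cast hc
  have hT : (0 : ℝ) < 1 / |((g 1 0 : ℤ) : ℝ)| := by positivity
  -- tail
  have htail : IntegrableOn (fun t : ℝ ↦
      f (ofComplex (((g 0 0 : ℤ) : ℂ) / ((g 1 0 : ℤ) : ℂ) + t * I)) *
        (((g 0 0 : ℤ) : ℂ) / ((g 1 0 : ℤ) : ℂ) + t * I) ^ j) (Ioi (1 / |((g 1 0 : ℤ) : ℝ)|)) := by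
    rw [integrableOn_Ioi_iff_integrableOn_Ioi_add]
    have := (isCuspFunction_one f).integrableOn_ray_mul_pow (g • ofComplex (rayBase g)) j
    rw [coe_smul_rayBase g hc] at this
    refine this.congr_fun (fun t _ ↦ ?_) measurableSet_Ioi
    dsimp only
    have e : ((g 0 0 : ℤ) : ℂ) / ((g 1 0 : ℤ) : ℂ) + ((1 / |((g 1 0 : ℤ) : ℝ)| : ℝ) : ℂ) * I +
        (t : ℂ) * I = ((g 0 0 : ℤ) : ℂ) / ((g 1 0 : ℤ) : ℂ) +
          ((t + 1 / |((g 1 0 : ℤ) : ℝ)| : ℝ) : ℂ) * I := by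
      push_cast; ring
    rw [e]
  -- head: bounded polynomial factor on the compact `[0, 1/|c|]`
  have hhead : IntegrableOn (fun t : ℝ ↦
      f (ofComplex (((g 0 0 : ℤ) : ℂ) / ((g 1 0 : ℤ) : ℂ) + t * I)) *
        (((g 0 0 : ℤ) : ℂ) / ((g 1 0 : ℤ) : ℂ) + t * I) ^ j) (Ioc 0 (1 / |((g 1 0 : ℤ) : ℝ)|)) :=
    ((integrableOn_Ioc_iff_integrableOn_Ioo).mpr
      (integrableOn_cuspRay_head f g hc)).mul_continuousOn_of_subset
      (by fun_prop) measurableSet_Ioc isCompact_Icc Ioc_subset_Icc_self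
  rw [← Ioc_union_Ioi_eq_Ioi hT.le]
  exact hhead.union htail

/-- **Integrability of `t ↦ f(r + it)(r + it)ʲ` on `(0, ∞)` at a rational cusp `r`**, every
`j ∈ ℕ`, every weight (`r = δ_r ∞` with `δ_r = cuspMatrix r`). [cite: Manin1973, §1] -/
theorem integrableOn_cuspRay_mul_pow_rat (r : ℚ) (j : ℕ) :
    IntegrableOn (fun t : ℝ ↦ f (ofComplex ((r : ℂ) + t * I)) * ((r : ℂ) + t * I) ^ j) (Ioi 0) := by
  have h := integrableOn_cuspRay_mul_pow f (cuspMatrix r) (cuspMatrix_apply_one_zero_ne_zero r) j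
  have hr : ((cuspMatrix r 0 0 : ℤ) : ℂ) / ((cuspMatrix r 1 0 : ℤ) : ℂ) = (r : ℂ) := by
    rw [cuspMatrix_apply_zero_zero, cuspMatrix_apply_one_zero]
    exact_mod_cast Rat.num_div_den r
  simpa only [hr] using h

end CuspRays

/-! ### The cusp ray moments `∫_x^{i∞} f(z) zʲ dz` -/

section Moments

variable {N : ℕ} {k : ℤ}

/-- **The cusp ray moment** `rayMoment φ j x = ∫_x^{i∞} φ(z) zʲ dz := i ∫₀^∞ φ(x + it)(x + it)ʲ dt`
(`z = x + it`, `dz = i dt`) of a function on `ℍ` at a real point `x` (a Bochner integral; for a cusp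
form and a rational `x` the integrand is integrable, `integrableOn_cuspRay_mul_pow_rat`).  At
`x = γ∞` these are the moments `Φ_f({∞} − {x})(zʲ)` (up to orientation) entering the
Mazur–Tate–Teitelbaum measure. [cite: Manin1973, §1] -/
def rayMoment (φ : ℍ → ℂ) (j : ℕ) (x : ℝ) : ℂ :=
  I * ∫ t in Ioi (0 : ℝ), φ (ofComplex ((x : ℂ) + t * I)) * ((x : ℂ) + t * I) ^ j

/-- Unfolding lemma. [folklore] -/
theorem rayMoment_def (φ : ℍ → ℂ) (j : ℕ) (x : ℝ) :
    rayMoment φ j x = I * ∫ t in Ioi (0 : ℝ), φ (ofComplex ((x : ℂ) + t * I)) * ((x : ℂ) + t * I) ^ j :=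
  rfl

/-- **At the cusp `0`**: `∫_0^{i∞} f(z) zʲ dz = i^{j+1} Λ(f, j+1)`, `Λ(f, n) = ∫₀^∞ f(it) t^{n−1} dt`
the tree's `completedLValue` (Paşol–Popa, eq. (5.7): `r_n(f) = i^{n+1} Λ(n+1, f)`). [cite: PasolPopa2013, eq. (5.7)] -/
theorem rayMoment_zero (f : CuspForm (Gamma0 N) k) (j : ℕ) :
    rayMoment (⇑f) j 0 = I ^ (j + 1) * completedLValue f (j + 1) := by
  rw [rayMoment_def, completedLValue_def, Nat.add_sub_cancel]
  have hfun : (fun t : ℝ ↦ f (ofComplex (((0 : ℝ) : ℂ) + t * I)) * (((0 : ℝ) : ℂ) + t * I) ^ j) =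
      fun t : ℝ ↦ I ^ j * ((t : ℂ) ^ j * f (ofComplex ((t : ℂ) * I))) := by
    funext t
    simp only [ofReal_zero, zero_add, mul_pow]
    ring
  rw [hfun, integral_const_mul, pow_succ]
  ring

variable [NeZero N]

/-- **Translation**: `∫_{r+1}^{i∞} f(z) zʲ dz = ∑ᵢ C(j,i) ∫_r^{i∞} f(z) zⁱ dz` for `f ∈ S_k(Γ₀(N))`
(`f(z + 1) = f(z)`, `(z + 1)ʲ = ∑ᵢ C(j,i) zⁱ`), at a rational cusp `r`. [cite: Manin1973, §1] -/
theorem rayMoment_add_one (f : CuspForm (Gamma0 N) k) (j : ℕ) (r : ℚ) :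
    rayMoment (⇑f) j ((r : ℝ) + 1) =
      ∑ i ∈ Finset.range (j + 1), (j.choose i : ℂ) * rayMoment (⇑f) i r := by
  have hper := (isCuspFunction_one f).periodic
  simp only [rayMoment_def]
  push_cast
  have hint : ∀ i ∈ Finset.range (j + 1), IntegrableOn (fun t : ℝ ↦ (j.choose i : ℂ) *
      (f (ofComplex ((r : ℂ) + t * I)) * ((r : ℂ) + t * I) ^ i)) (Ioi 0) :=
    fun i _ ↦ (integrableOn_cuspRay_mul_pow_rat f r i).const_mul _
  have key : ∀ t : ℝ, f (ofComplex ((r : ℂ) + 1 + t * I)) * ((r : ℂ) + 1 + t * I) ^ j =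
      ∑ i ∈ Finset.range (j + 1), (j.choose i : ℂ) *
        (f (ofComplex ((r : ℂ) + t * I)) * ((r : ℂ) + t * I) ^ i) := by
    intro t
    have h1 : f (ofComplex ((r : ℂ) + 1 + t * I)) = f (ofComplex ((r : ℂ) + t * I)) := by
      have := hper ((r : ℂ) + t * I)
      simp only [comp_apply] at this
      rw [← this]
      congr 2
      push_cast
      ring
    have h2 : ((r : ℂ) + 1 + t * I) = ((r : ℂ) + t * I) + 1 := by ring
    rw [h1, h2, add_pow]
    simp only [one_pow, mul_one]
    rw [Finset.mul_sum]
    refine Finset.sum_congr rfl fun i _ ↦ ?_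
    ring
  simp_rw [key]
  rw [integral_finsetSum _ hint, Finset.mul_sum]
  refine Finset.sum_congr rfl fun i _ ↦ ?_
  rw [integral_const_mul]
  ring

omit [NeZero N] in
/-- **Scaling along the ray** (the change of variables behind the level-`m` operators `(1 b; 0 m)`):
`∫₀^∞ F((x + b)/m + it) G(t) dt = (1/m) ∫₀^∞ F(((x + b) + is)/m) G(s/m) ds` for any `F : ℍ → ℂ`,
`G : ℝ → ℂ` and `m ≥ 1` (both sides are junk together when divergent). Summed over `b mod m` with
`∑_b F((w + b)/m) = m (U_m F)(w)` this is the distribution relation of the Mazur–Tate–Teitelbaum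
measure (Bellaïche, *The Eigenbook*, §6.7.3). [folklore] -/
theorem integral_cuspRay_comp_div (F : ℍ → ℂ) (G : ℝ → ℂ) (x b : ℝ) {m : ℕ} (hm : 0 < m) :
    ∫ t in Ioi (0 : ℝ), F (ofComplex ((((x + b) / m : ℝ) : ℂ) + t * I)) * G t =
      (m : ℂ)⁻¹ * ∫ s in Ioi (0 : ℝ), F (ofComplex (((((x + b : ℝ) : ℂ) + s * I) / m))) * G (s / m) := by
  have hm' : (0 : ℝ) < m := by exact_mod_cast hm
  have hmC : (m : ℂ) ≠ 0 := by exact_mod_cast hm.ne'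
  have h := integral_comp_mul_left_Ioi
    (fun s : ℝ ↦ F (ofComplex (((((x + b : ℝ) : ℂ) + s * I) / m))) * G (s / m)) 0 hm'
  rw [mul_zero] at h
  have hfun : ∀ t : ℝ, F (ofComplex (((((x + b : ℝ) : ℂ) + ((m * t : ℝ) : ℂ) * I) / m))) * G (m * t / m) =
      F (ofComplex ((((x + b) / m : ℝ) : ℂ) + t * I)) * G t := by
    intro t
    rw [mul_div_cancel_left₀ t hm'.ne']
    congr 3
    push_cast
    field_simp
  simp only [hfun] at h
  rw [h, Complex.real_smul]
  push_cast
  ring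

end Moments

/-! ### The distribution relation engine: summing over the cusps `(r + b)/p` -/

section Distribution

variable {L : ℕ} [NeZero L] {k : ℤ} {p : ℕ} [NeZero p]

/-- **`∑_{b mod p} F((τ + b)/p) = p · (U_p F)(τ)`** for `F ∈ S_k(Γ₀(L))` with `p ∣ L` prime: by
Diamond–Shurman Prop. 5.2.1 (`coe_heckeT_gamma0_eq_sum`) `T_p = U_p = ∑_b [(1 b; 0 p)]_k` at such a
level, and `(F ∣[k] (1 b; 0 p))(τ) = p⁻¹ F((τ + b)/p)` (`slash_tpB_apply`). [cite: DiamondShurman2005, Prop. 5.2.1] -/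
theorem sum_apply_tpB_smul (hp : p.Prime) (hpL : p ∣ L) (F : CuspForm (Gamma0 L) k) (τ : ℍ) :
    ∑ b : Fin p, F (tpB p ((b : ℕ) : ℤ) • τ) = (p : ℂ) * heckeT (Gamma0 L) k p F τ := by
  have hp0 : (p : ℂ) ≠ 0 := by exact_mod_cast hp.ne_zero
  have h := congrFun (coe_heckeT_gamma0_eq_sum L k p hp F) τ
  rw [if_pos hpL, add_zero, Finset.sum_apply] at h
  simp only [slash_tpB_apply] at h
  rw [h, Finset.mul_sum]
  refine Finset.sum_congr rfl fun b _ ↦ ?_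
  rw [mul_inv_cancel_left₀ hp0]

/-- `(1 b; 0 p) · (x + is) = ((x + b) + is)/p` read through `ofComplex`. [folklore] -/
theorem tpB_smul_ofComplex_ray (b : ℤ) (x : ℝ) {s : ℝ} (hs : 0 < s) :
    tpB p b • ofComplex ((x : ℂ) + s * I) = ofComplex ((((x + b : ℝ) : ℂ) + s * I) / p) := by
  have him : 0 < ((x : ℂ) + s * I).im := by simpa using hs
  have hp0 : (0 : ℝ) < p := by exact_mod_cast NeZero.pos p
  have him' : 0 < (((((x + b : ℝ) : ℂ) + s * I) / p)).im := by
    rw [div_natCast_im]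
    simpa using div_pos hs hp0
  apply UpperHalfPlane.ext
  rw [coe_tpB_smul, ofComplex_apply_of_im_pos him, ofComplex_apply_of_im_pos him']
  push_cast
  ring

/-- **The distribution relation engine.** For `F ∈ S_k(Γ₀(L))`, `p ∣ L` prime, a real point `r` and
a weight `G`: `∑_{b mod p} ∫₀^∞ F((r + b)/p + it) G(t) dt = ∫₀^∞ (U_p F)(r + is) G(s/p) ds`, granted
integrability of the `p` integrands on the left (e.g. `G` polynomial and `r` rational,
`integrableOn_cuspRay_mul_pow_rat`).  With `U_p F = α F` this is
`∑_b Φ_F({∞} − {(r+b)/p})(G) = α ∫₀^∞ F(r + is) G(s/p) ds`, the additivity of the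
Mazur–Tate–Teitelbaum distribution `μ(zʲ 1_{a + pⁿℤ_p}) = α^{−n} Φ_F({∞} − {a/pⁿ})((a + pⁿ z)ʲ)`
(Bellaïche, *The Eigenbook*, §6.7.3; MTT 1986, §I.10). [cite: MazurTateTeitelbaum1986Invent, §I.10] -/
theorem sum_integral_cuspRay_div_eq (hp : p.Prime) (hpL : p ∣ L) (F : CuspForm (Gamma0 L) k)
    (r : ℝ) (G : ℝ → ℂ)
    (hint : ∀ b : Fin p, IntegrableOn
      (fun t : ℝ ↦ F (ofComplex ((((r + b) / p : ℝ) : ℂ) + t * I)) * G t) (Ioi 0)) :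
    ∑ b : Fin p, ∫ t in Ioi (0 : ℝ), F (ofComplex ((((r + b) / p : ℝ) : ℂ) + t * I)) * G t =
      ∫ s in Ioi (0 : ℝ), heckeT (Gamma0 L) k p F (ofComplex ((r : ℂ) + s * I)) * G (s / p) := by
  have hp0 : 0 < p := hp.pos
  have hpR : (0 : ℝ) < p := by exact_mod_cast hp0
  have hpC : (p : ℂ) ≠ 0 := by exact_mod_cast hp.ne_zero
  -- rescale each ray
  have hscale : ∀ b : Fin p, ∫ t in Ioi (0 : ℝ), F (ofComplex ((((r + b) / p : ℝ) : ℂ) + t * I)) * G t =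
      (p : ℂ)⁻¹ * ∫ s in Ioi (0 : ℝ),
        F (ofComplex (((((r + b : ℝ) : ℂ) + s * I) / p))) * G (s / p) :=
    fun b ↦ integral_cuspRay_comp_div (⇑F) G r b hp0
  -- integrability of the rescaled integrands
  have hint' : ∀ b ∈ (Finset.univ : Finset (Fin p)), IntegrableOn (fun s : ℝ ↦
      F (ofComplex (((((r + b : ℝ) : ℂ) + s * I) / p))) * G (s / p)) (Ioi 0) := by
    intro b _
    have h := (integrableOn_Ioi_comp_mul_left_iff
      (fun t : ℝ ↦ F (ofComplex ((((r + b) / p : ℝ) : ℂ) + t * I)) * G t) 0 (inv_pos.mpr hpR)).mpr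
      (by rw [mul_zero]; exact hint b)
    refine h.congr_fun (fun s _ ↦ ?_) measurableSet_Ioi
    dsimp only
    rw [inv_mul_eq_div]
    congr 3
    push_cast
    field_simp
  simp_rw [hscale]
  rw [← Finset.mul_sum, ← integral_finsetSum _ hint']
  rw [← integral_const_mul]
  refine setIntegral_congr_fun measurableSet_Ioi fun s (hs : 0 < s) ↦ ?_
  have key : ∑ b : Fin p, F (ofComplex (((((r + (b : ℕ) : ℝ) : ℂ) + s * I) / p))) =
      (p : ℂ) * heckeT (Gamma0 L) k p F (ofComplex ((r : ℂ) + s * I)) := by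
    rw [← sum_apply_tpB_smul hp hpL F]
    refine Finset.sum_congr rfl fun b _ ↦ ?_
    rw [tpB_smul_ofComplex_ray (((b : ℕ) : ℤ)) r hs]
    push_cast
    ring_nf
  rw [← Finset.sum_mul, key, ← mul_assoc, inv_mul_cancel_left₀ hpC]

/-- **Eigen-version**: if moreover `U_p F = α F` then
`∑_{b mod p} ∫₀^∞ F((r + b)/p + it) G(t) dt = α ∫₀^∞ F(r + is) G(s/p) ds`. [cite: MazurTateTeitelbaum1986Invent, §I.10] -/
theorem sum_integral_cuspRay_div_eq_of_eigen (hp : p.Prime) (hpL : p ∣ L) (F : CuspForm (Gamma0 L) k)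
    {α : ℂ} (hU : heckeT (Gamma0 L) k p F = α • F) (r : ℝ) (G : ℝ → ℂ)
    (hint : ∀ b : Fin p, IntegrableOn
      (fun t : ℝ ↦ F (ofComplex ((((r + b) / p : ℝ) : ℂ) + t * I)) * G t) (Ioi 0)) :
    ∑ b : Fin p, ∫ t in Ioi (0 : ℝ), F (ofComplex ((((r + b) / p : ℝ) : ℂ) + t * I)) * G t =
      α * ∫ s in Ioi (0 : ℝ), F (ofComplex ((r : ℂ) + s * I)) * G (s / p) := by
  rw [sum_integral_cuspRay_div_eq hp hpL F r G hint, hU, ← integral_const_mul]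
  refine setIntegral_congr_fun measurableSet_Ioi fun s _ ↦ ?_
  simp only [CuspForm.IsGLPos.coe_smul, Pi.smul_apply, smul_eq_mul]
  ring

end Distribution

end Literature.NumberTheory.EllipticCurves.ModularForms

end
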